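import Literature.Computability.QuantumComplexity.AaronsonAmbainisProofs
import HarnessLib

/-!
# The Aaronson–Ambainis simulation tree as an iterative, answer-driven walk

Companion of `AaronsonAmbainisProofs.lean` (the decision tree `ClassicalSimulation.simTree θ w D p`
of Aaronson–Ambainis' Thm. 21 = Thm. 3.3: "if `Var[p_j] ≤ θ` output `E[p_j]`, otherwise query an
`i` with `Inf_i[p_j] ≥ w` and pass to the restriction"). A machine implementing the tree — as
required by the polynomial-TIME form of the simulation in the proof of Thm. 23 (arXiv:0911.0996v3,
p. 14; the obligation `aaronsonAmbainis2014_thm23_apx_of_dyadicMachines` of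
`AaronsonAmbainisThm23Reduction.lean`) — does not hold the tree: it holds the list `ρ` of
(variable, answer) pairs queried so far, recomputes the node polynomial `p_ρ`, and decides from
`p_ρ` alone whether to halt (and what to output) or which variable to query next. Moreover, in
the tree's transcript model of oracle machines (`Complexity.AdQuery.adAlg`: the query generator
sees the input and the ANSWER BITS received so far) the variables queried earlier are not part of
the transcript and are recomputed from the answers. This file provides exactly that presentation
and proves it evaluates the tree:

* `nodePoly p ρ` — the node polynomial `p|_ρ` (restrictions applied in order);
* `nextVar θ w D p ρ` — the variable queried at node `ρ` (`none` = halt: budget `D` exhausted,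
  `Var[p_ρ] ≤ θ`, or no influential variable), `stepR`/`walkR θ w D p bs` — the node reached after
  the answer bits `bs` (answers arriving after the halt are ignored), with the shift lemmas
  (`nextVar_cons`, `walkR_cons_cons`) reducing the walk below a query to the walk of the subtree;
* `Answers θ w D p y bs` — "`bs` are the answers of the point `y`": the `t`-th bit is `y i` for
  the variable `i` queried after the first `t` answers;
* **`eval_simTree_eq_of_answers`**: for such `bs` of length `≥ D`,
  `(simTree θ w D p).eval y = E[p_ρ]` with `ρ = walkR θ w D p bs` — so the machine's output
  `[E[p_ρ] ≥ 1/2]` is the tree's thresholded output (`simTree_output_eq_of_answers`).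

No named facts; definitions are the machine-facing reformulation of `simTree`.

## References

* S. Aaronson, A. Ambainis, *The need for structure in quantum speedups*, Theory Comput. 10
  (2014), Thm. 21 (= Thm. 3.3, the algorithm) and proof of Thm. 23 (arXiv:0911.0996v3, p. 14:
  "we can implement `C` using … `poly(n)` computation steps") [AaronsonAmbainis2014].
* S. Arora, B. Barak, *Computational Complexity: A Modern Approach*, CUP 2009, §3.4 (oracle
  machines: the next query depends on the previous answers).
-/

noncomputable section

namespace Literature.Computability.QuantumComplexity

namespace ClassicalSimulation

variable {N : ℕ} (θ w : ℝ)

/-! ### Node polynomials -/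

/-- **The node polynomial** `p|_ρ` after the restrictions `ρ = [(i₁,b₁), …, (i_k,b_k)]`, applied
in this order. [cite: AaronsonAmbainis2014, Thm. 3.3 (proof: "p_{j+1} = restriction of p_j")] -/
def nodePoly (p : MvPolynomial (Fin N) ℝ) (ρ : List (Fin N × Bool)) : MvPolynomial (Fin N) ℝ :=
  ρ.foldl (fun q ib => restrictPoly ib.1 ib.2 q) p

/-- No restriction. [folklore] -/
@[simp] theorem nodePoly_nil (p : MvPolynomial (Fin N) ℝ) : nodePoly p [] = p := rfl

/-- The first restriction may be absorbed into the polynomial. [folklore] -/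
theorem nodePoly_cons (p : MvPolynomial (Fin N) ℝ) (i : Fin N) (b : Bool) (ρ : List (Fin N × Bool)) :
    nodePoly p ((i, b) :: ρ) = nodePoly (restrictPoly i b p) ρ := rfl

/-- One more restriction. [folklore] -/
theorem nodePoly_append_singleton (p : MvPolynomial (Fin N) ℝ) (ρ : List (Fin N × Bool)) (i : Fin N) (b : Bool) :
    nodePoly p (ρ ++ [(i, b)]) = restrictPoly i b (nodePoly p ρ) := by
  simp [nodePoly, List.foldl_append]

/-- On the cube, `p|_ρ (y)` is `p` at `y` overridden by `ρ` (earlier entries outermost). [folklore] -/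
theorem evalBool_nodePoly (p : MvPolynomial (Fin N) ℝ) :
    ∀ (ρ : List (Fin N × Bool)) (y : Fin N → Bool),
      evalBool (nodePoly p ρ) y = evalBool p (ρ.foldr (fun ib z => Function.update z ib.1 ib.2) y)
  | [], y => rfl
  | (i, b) :: ρ, y => by
    rw [nodePoly_cons, evalBool_nodePoly (restrictPoly i b p) ρ y, evalBool_restrictPoly, List.foldr_cons]

/-! ### The answer-driven walk -/

section Walk

variable (D : ℕ) (p : MvPolynomial (Fin N) ℝ)

/-- **The variable queried at node `ρ`**, or `none` if the walk halts there: the budget `D` is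
exhausted, or `Var[p_ρ] ≤ θ`, or (impossible under Conjecture 6) no variable has influence `≥ w`;
otherwise the least influential-enough variable (`pickVar`). [cite: AaronsonAmbainis2014, Thm. 3.3 (proof)] -/
def nextVar (ρ : List (Fin N × Bool)) : Option (Fin N) :=
  if ρ.length < D ∧ ¬ boolVariance (nodePoly p ρ) ≤ θ then pickVar w (nodePoly p ρ) else none

/-- **One answer**: if the walk is live at `ρ`, record the answer `b` for the queried variable;
otherwise ignore it. [cite: AaronsonAmbainis2014, Thm. 3.3 (proof)] -/
def stepR (ρ : List (Fin N × Bool)) (b : Bool) : List (Fin N × Bool) :=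
  match nextVar θ w D p ρ with
  | some i => ρ ++ [(i, b)]
  | none => ρ

/-- **The node reached after the answer bits `bs`.** [cite: AaronsonAmbainis2014, Thm. 3.3 (proof)] -/
def walkR (bs : List Bool) : List (Fin N × Bool) :=
  bs.foldl (stepR θ w D p) []

variable {θ w D p}

/-- A halted walk ignores answers. [folklore] -/
theorem stepR_of_none {ρ : List (Fin N × Bool)} (h : nextVar θ w D p ρ = none) (b : Bool) :
    stepR θ w D p ρ b = ρ := by
  simp [stepR, h]

/-- A live walk records the answer. [folklore] -/
theorem stepR_of_some {ρ : List (Fin N × Bool)} {i : Fin N} (h : nextVar θ w D p ρ = some i) (b : Bool) :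
    stepR θ w D p ρ b = ρ ++ [(i, b)] := by
  simp [stepR, h]

/-- A halted walk ignores all further answers. [folklore] -/
theorem foldl_stepR_of_none {ρ : List (Fin N × Bool)} (h : nextVar θ w D p ρ = none) :
    ∀ bs : List Bool, bs.foldl (stepR θ w D p) ρ = ρ
  | [] => rfl
  | b :: bs => by rw [List.foldl_cons, stepR_of_none h, foldl_stepR_of_none h bs]

/-- No answers, root node. [folklore] -/
@[simp] theorem walkR_nil : walkR θ w D p [] = [] := rfl

/-- One more answer. [folklore] -/
theorem walkR_append_singleton (bs : List Bool) (b : Bool) :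
    walkR θ w D p (bs ++ [b]) = stepR θ w D p (walkR θ w D p bs) b := by
  simp [walkR, List.foldl_append]

/-- If the root halts, the walk stays at the root. [folklore] -/
theorem walkR_of_root_none (h : nextVar θ w D p [] = none) (bs : List Bool) : walkR θ w D p bs = [] :=
  foldl_stepR_of_none h bs

/-- With budget `0` every node halts. [folklore] -/
theorem nextVar_zero (p : MvPolynomial (Fin N) ℝ) (ρ : List (Fin N × Bool)) : nextVar θ w 0 p ρ = none := by
  simp [nextVar]

/-- At the root: halt iff `Var[p] ≤ θ` or no influential variable, else `pickVar`. [folklore] -/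
theorem nextVar_succ_nil (D : ℕ) (p : MvPolynomial (Fin N) ℝ) :
    nextVar θ w (D + 1) p [] = if boolVariance p ≤ θ then none else pickVar w p := by
  by_cases h : boolVariance p ≤ θ <;> simp [nextVar, h]

/-! ### Shifting the walk below the first query -/

/-- **Shift**: the decision at node `(i, b) :: ρ` of the walk for `(p, D + 1)` is the decision at
node `ρ` of the walk for `(p|_{xᵢ := b}, D)`. [folklore] -/
theorem nextVar_cons (D : ℕ) (p : MvPolynomial (Fin N) ℝ) (i : Fin N) (b : Bool) (ρ : List (Fin N × Bool)) :
    nextVar θ w (D + 1) p ((i, b) :: ρ) = nextVar θ w D (restrictPoly i b p) ρ := by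
  simp only [nextVar, List.length_cons, Nat.succ_lt_succ_iff, nodePoly_cons]

/-- Shift for one answer. [folklore] -/
theorem stepR_cons (D : ℕ) (p : MvPolynomial (Fin N) ℝ) (i : Fin N) (b : Bool) (ρ : List (Fin N × Bool)) (b' : Bool) :
    stepR θ w (D + 1) p ((i, b) :: ρ) b' = (i, b) :: stepR θ w D (restrictPoly i b p) ρ b' := by
  simp only [stepR, nextVar_cons]
  cases nextVar θ w D (restrictPoly i b p) ρ <;> rfl

/-- Shift for a list of answers. [folklore] -/
theorem foldl_stepR_cons (D : ℕ) (p : MvPolynomial (Fin N) ℝ) (i : Fin N) (b : Bool) :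
    ∀ (bs : List Bool) (ρ : List (Fin N × Bool)),
      bs.foldl (stepR θ w (D + 1) p) ((i, b) :: ρ) = (i, b) :: bs.foldl (stepR θ w D (restrictPoly i b p)) ρ
  | [], ρ => rfl
  | b' :: bs, ρ => by rw [List.foldl_cons, List.foldl_cons, stepR_cons, foldl_stepR_cons D p i b bs]

/-- **The walk below a query**: if the root of `(p, D + 1)` queries `i`, then after the answers
`b :: bs` the walk is at `(i, b) ::` (the walk of `(p|_{xᵢ := b}, D)` after `bs`). [folklore] -/
theorem walkR_cons_cons {D : ℕ} {p : MvPolynomial (Fin N) ℝ} {i : Fin N} (h : nextVar θ w (D + 1) p [] = some i)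
    (b : Bool) (bs : List Bool) :
    walkR θ w (D + 1) p (b :: bs) = (i, b) :: walkR θ w D (restrictPoly i b p) bs := by
  unfold walkR
  rw [List.foldl_cons, stepR_of_some h, List.nil_append, foldl_stepR_cons]

/-! ### Answer lists of a point of the cube -/

variable (θ w D p)

/-- **`bs` are the answers of the point `y`**: whenever the walk is live after the first `t`
answers and queries `i`, the `t`-th answer is `y i`. (Answers after the halt are arbitrary.)
[cite: AaronsonAmbainis2014, Thm. 3.3 (proof)] -/
def Answers (y : Fin N → Bool) (bs : List Bool) : Prop :=
  ∀ (t : ℕ) (ht : t < bs.length) (i : Fin N), nextVar θ w D p (walkR θ w D p (bs.take t)) = some i → bs[t] = y i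

variable {θ w D p}

/-- The answers of `y` below the first query are answers of `y` for the subtree. [folklore] -/
theorem Answers.tail {D : ℕ} {p : MvPolynomial (Fin N) ℝ} {i : Fin N} (h : nextVar θ w (D + 1) p [] = some i)
    {y : Fin N → Bool} {b : Bool} {bs : List Bool} (hA : Answers θ w (D + 1) p y (b :: bs)) :
    Answers θ w D (restrictPoly i b p) y bs := by
  intro t ht j hj
  have := hA (t + 1) (by simpa using ht) j (by rwa [List.take_succ_cons, walkR_cons_cons h, nextVar_cons])
  simpa using this

/-- The first answer of `y` is `y i` for the root query `i`. [folklore] -/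
theorem Answers.head {D : ℕ} {p : MvPolynomial (Fin N) ℝ} {i : Fin N} (h : nextVar θ w (D + 1) p [] = some i)
    {y : Fin N → Bool} {b : Bool} {bs : List Bool} (hA : Answers θ w (D + 1) p y (b :: bs)) : b = y i := by
  have := hA 0 (by simp) i (by simpa using h)
  simpa using this

/-! ### The walk evaluates the tree -/

/-- **The answer-driven walk evaluates the simulation tree**: for the answers `bs` of `y`, at
least `D` of them, `(simTree θ w D p)(y) = E[p_ρ]` at the node `ρ = walkR θ w D p bs`.
[cite: AaronsonAmbainis2014, Thm. 3.3 (proof) and Thm. 23 (proof, p. 14)] -/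
theorem eval_simTree_eq_of_answers :
    ∀ (D : ℕ) (p : MvPolynomial (Fin N) ℝ) (y : Fin N → Bool) (bs : List Bool), D ≤ bs.length →
      Answers θ w D p y bs →
        (simTree θ w D p).eval y = boolAvg (evalBool (nodePoly p (walkR θ w D p bs)))
  | 0, p, y, bs, _, _ => by
    rw [walkR_of_root_none (nextVar_zero p [])]
    simp [simTree]
  | D + 1, p, y, bs, hlen, hA => by
    by_cases hv : boolVariance p ≤ θ
    · have hroot : nextVar θ w (D + 1) p [] = none := by rw [nextVar_succ_nil, if_pos hv]
      rw [simTree_succ_of_le θ w hv, walkR_of_root_none hroot]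
      simp
    · cases hp : pickVar w p with
      | none =>
        have hroot : nextVar θ w (D + 1) p [] = none := by rw [nextVar_succ_nil, if_neg hv, hp]
        rw [simTree_succ_of_none θ w hv hp, walkR_of_root_none hroot]
        simp
      | some i =>
        have hroot : nextVar θ w (D + 1) p [] = some i := by rw [nextVar_succ_nil, if_neg hv, hp]
        cases bs with
        | nil => simp at hlen
        | cons b bs =>
          have hb : b = y i := hA.head hroot
          have ih := eval_simTree_eq_of_answers D (restrictPoly i b p) y bs (by simpa using hlen) (hA.tail hroot)
          rw [simTree_succ_of_some θ w hv hp, RealDecisionTree.eval_query, walkR_cons_cons hroot, nodePoly_cons, ← ih]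
          subst hb
          cases y i <;> rfl

/-- **The thresholded output**: for the answers of `y`,
`[(simTree θ w D p)(y) ≥ 1/2] = [E[p_ρ] ≥ 1/2]` at `ρ = walkR θ w D p bs` — the bit a machine
outputs from its final node. [cite: AaronsonAmbainis2014, Thm. 23 (proof, p. 14), Cor. 22] -/
theorem simTree_output_eq_of_answers {D : ℕ} {p : MvPolynomial (Fin N) ℝ} {y : Fin N → Bool} {bs : List Bool}
    (hlen : D ≤ bs.length) (hA : Answers θ w D p y bs) :
    decide ((1 : ℝ) / 2 ≤ (simTree θ w D p).eval y) =
      decide ((1 : ℝ) / 2 ≤ boolAvg (evalBool (nodePoly p (walkR θ w D p bs)))) := by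
  rw [eval_simTree_eq_of_answers D p y bs hlen hA]

/-! ### The walk never exceeds the budget -/

/-- Invariant of the walk: the node list has at most `D` entries and grows by at most one per answer. [folklore] -/
theorem length_foldl_stepR_le : ∀ (bs : List Bool) (ρ : List (Fin N × Bool)), ρ.length ≤ D →
    (bs.foldl (stepR θ w D p) ρ).length ≤ D ∧ (bs.foldl (stepR θ w D p) ρ).length ≤ ρ.length + bs.length
  | [], ρ, hρ => by simpa using hρ
  | b :: bs, ρ, hρ => by
    rw [List.foldl_cons]
    cases hn : nextVar θ w D p ρ with
    | none =>
      rw [stepR_of_none hn]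
      obtain ⟨h1, h2⟩ := length_foldl_stepR_le bs ρ hρ
      exact ⟨h1, h2.trans (by simp)⟩
    | some i =>
      have hlt : ρ.length < D := by
        unfold nextVar at hn; split_ifs at hn with hc; exact hc.1
      rw [stepR_of_some hn]
      obtain ⟨h1, h2⟩ := length_foldl_stepR_le bs (ρ ++ [(i, b)]) (by simpa using hlt)
      exact ⟨h1, h2.trans (by simp; omega)⟩

/-- **The walk makes at most `D` queries.** [cite: AaronsonAmbainis2014, Thm. 3.3 (proof: "at most D queries")] -/
theorem length_walkR_le (bs : List Bool) : (walkR θ w D p bs).length ≤ D :=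
  (length_foldl_stepR_le bs [] (Nat.zero_le _)).1

/-- The walk records at most one variable per answer. [folklore] -/
theorem length_walkR_le_length (bs : List Bool) : (walkR θ w D p bs).length ≤ bs.length := by
  have := (length_foldl_stepR_le (θ := θ) (w := w) (D := D) (p := p) bs [] (Nat.zero_le _)).2
  simpa [walkR] using this

end Walk

end ClassicalSimulation

end Literature.Computability.QuantumComplexity

end
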